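import Summits.Parity.GeneralizedHardyLittlewood.Theorems.EH.Negative.EHFloor
import Literature.NumberTheory.Sieve.LevelOfDistributionProofs

/-!
# `ElliottHalberstam` (cruxes stmt-Parity-14985 / 14092 / 11314): the FIXED-RESIDUE form
# (negative-side support, `sorry`-free)

The crux of the conditional routes `LiouvilleShiftedTables` / `LiouvilleMAD` is, by name, the
Elliott–Halberstam conjecture `Literature.NumberTheory.Sieve.LevelOfDistribution.ElliottHalberstam =
∀ θ < 1, PrimesHaveLevel θ` (sup over heights `1 ≤ y ≤ x` and over ALL reduced classes `a`).  Both
routes CONSUME it at one fixed residue only (`−h`, for the shifted primes `Λ(n) Λ(n+h)`: PairsFromMAvg /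
LevelToPairs, Bombieri's asymptotic sieve at level `1 − ε₀/2`), and the re-bridging question raised on
this crux (Cruxes/ElliottHalberstam/IdeatorMemo3 §0, Cruxes/ElliottHalberstamCond/IdeatorMemo-14985-r1k1 §3)
is whether the premise should be the fixed-residue statement instead.  This file records, kernel-checked:

* `fixedResidueSum h x Q = ∑_{q ≤ Q, (q,h)=1} |ψ(x; q, −h) − x/φ(q)|` and the fixed-residue level
  notions `PrimesHaveLevelFixedResidue h θ` (level `x^{θ−ε}`, every `ε > 0`),
  `PrimesHaveSharpLevelFixedResidue h θ` (level `x^θ` exactly), `ElliottHalberstamFixedResidue h`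
  (`∀ θ < 1`);
* §1 `fixedResidueSum_le_sum_primeAPError`, `PrimesHaveLevel.fixedResidue`,
  `elliottHalberstamFixedResidue_of_elliottHalberstam`: the fixed-residue premise is IMPLIED by the crux
  (it is a sub-sum of the Bombieri–Vinogradov sum at height `y = x`) — re-bridging on it weakens the
  routes' hypothesis, never strengthens it;
* §2 `fixedResidueSum_floor`: for every `h ≥ 1` there is `c = c(h) > 0` with
  `∑_{q ≤ x, (q,h)=1} |ψ(x; q, −h) − x/φ(q)| ≥ c·x` for all large `x` — witness moduli
  `q = h + p₁p₂(1 + hk) ∈ ((x+h)/2, x]` (`p₁ < p₂` primes `> h`): the class `−h (mod q)` meets `[0, x]`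
  only in `n = q − h = p₁p₂(1+hk)`, which is not a prime power, so `ψ(x; q, −h) = 0` against a main
  term `x/φ(q) ≥ 1`;
* §3 consequences: `not_primesHaveSharpLevelFixedResidue_one` — even for ONE fixed class and the single
  height `y = x`, level `x` exactly (`θ = 1`, `ε` dropped) is false, so the endpoint failure recorded for
  the full sum (`EHFloor.not_isBigO_levelSum_of_one_le`, `ElliottHalberstamLoadBearing.not_primesHaveSharpLevel_one`)
  is NOT an artefact of the suprema over `y` and `a`; `not_primesHaveLevelFixedResidue_of_one_lt`
  (`θ > 1` fails) and `elliottHalberstamFixedResidue_false_without_ltOne` (`θ < 1` is load-bearing in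
  the fixed-residue form too).  Hence a fixed-residue re-bridge must keep exactly the same open
  quantifier `θ < 1` / `ε > 0` as the crux.

Nothing here asserts the crux or any route item. [folklore]
-/

open Filter Asymptotics Finset
open Literature.NumberTheory.Sieve Literature.NumberTheory.Sieve.LevelOfDistribution

namespace Summit.Parity.GeneralizedHardyLittlewood.Theorems.ElliottHalberstam.Negative

/-! ### §0 The fixed-residue objects -/

/-- The fixed-residue Bombieri–Vinogradov sum at the class `−h`, height `y = x`:
`∑_{1 ≤ q ≤ Q, (q,h)=1} |ψ(x; q, −h) − x/φ(q)|`. [folklore] -/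
noncomputable def fixedResidueSum (h : ℕ) (x : ℝ) (Q : ℕ) : ℝ :=
  ∑ q ∈ (Icc 1 Q).filter (fun q => q.Coprime h),
    |chebyshevPsiMod q (-((h : ℕ) : ZMod q)) x - x / Nat.totient q|

/-- Fixed-residue level of distribution `x^θ` (with the usual `ε`-slack): for every `A > 0`, `ε > 0`,
`∑_{q ≤ x^{θ−ε}, (q,h)=1} |ψ(x; q, −h) − x/φ(q)| ≪ x/(log x)^A`. [folklore] -/
def PrimesHaveLevelFixedResidue (h : ℕ) (θ : ℝ) : Prop :=
  ∀ A : ℝ, 0 < A → ∀ ε : ℝ, 0 < ε →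
    (fun x : ℝ => fixedResidueSum h x ⌊x ^ (θ - ε)⌋₊) =O[atTop] fun x : ℝ => x / Real.log x ^ A

/-- Fixed-residue level `x^θ` EXACTLY (no `ε`). [folklore] -/
def PrimesHaveSharpLevelFixedResidue (h : ℕ) (θ : ℝ) : Prop :=
  ∀ A : ℝ, 0 < A →
    (fun x : ℝ => fixedResidueSum h x ⌊x ^ θ⌋₊) =O[atTop] fun x : ℝ => x / Real.log x ^ A

/-- The fixed-residue Elliott–Halberstam statement at the class `−h`: level `x^θ` for every `θ < 1`.
(The form consumed by Bombieri's asymptotic sieve for `Λ(n)Λ(n+h)`.) [folklore] -/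
def ElliottHalberstamFixedResidue (h : ℕ) : Prop :=
  ∀ θ : ℝ, θ < 1 → PrimesHaveLevelFixedResidue h θ

/-- The fixed-residue sum is nonnegative. [folklore] -/
theorem fixedResidueSum_nonneg (h : ℕ) (x : ℝ) (Q : ℕ) : 0 ≤ fixedResidueSum h x Q :=
  Finset.sum_nonneg fun _ _ => abs_nonneg _

/-- Monotonicity of the fixed-residue sum in the level `Q`. [folklore] -/
theorem fixedResidueSum_mono (h : ℕ) (x : ℝ) {Q Q' : ℕ} (hQ : Q ≤ Q') :
    fixedResidueSum h x Q ≤ fixedResidueSum h x Q' := by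
  unfold fixedResidueSum
  exact Finset.sum_le_sum_of_subset_of_nonneg
    (Finset.filter_subset_filter _ (Finset.Icc_subset_Icc le_rfl hQ)) fun _ _ _ => abs_nonneg _

/-! ### §1 The fixed-residue form is implied by the crux -/

/-- For `x ≥ 1`, the fixed-residue sum is a sub-sum of the Bombieri–Vinogradov sum
`∑_{q ≤ Q} E*(x; q)` (height `y = x`, class `−h ∈ (ℤ/q)ˣ`). [folklore] -/
theorem fixedResidueSum_le_sum_primeAPError (h : ℕ) {x : ℝ} (hx : 1 ≤ x) (Q : ℕ) :
    fixedResidueSum h x Q ≤ ∑ q ∈ Icc 1 Q, primeAPError x q := by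
  unfold fixedResidueSum
  calc ∑ q ∈ (Icc 1 Q).filter (fun q => q.Coprime h),
        |chebyshevPsiMod q (-((h : ℕ) : ZMod q)) x - x / Nat.totient q|
      ≤ ∑ q ∈ (Icc 1 Q).filter (fun q => q.Coprime h), primeAPError x q := by
        refine Finset.sum_le_sum fun q hq => ?_
        rw [Finset.mem_filter, Finset.mem_Icc] at hq
        have hq0 : q ≠ 0 := by omega
        have hcop : Nat.Coprime h q := hq.2.symm
        have key := abs_sub_le_primeAPError (x := x) hq0 hx le_rfl (-(ZMod.unitOfCoprime h hcop))
        rwa [Units.val_neg, ZMod.coe_unitOfCoprime] at key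
    _ ≤ ∑ q ∈ Icc 1 Q, primeAPError x q :=
        Finset.sum_le_sum_of_subset_of_nonneg (Finset.filter_subset _ _)
          fun q _ _ => primeAPError_nonneg x q

/-- **Level `x^θ` for the primes gives fixed-residue level `x^θ`** (every `h`). [folklore] -/
theorem _root_.Literature.NumberTheory.Sieve.PrimesHaveLevel.fixedResidue {θ : ℝ}
    (hθ : PrimesHaveLevel θ) (h : ℕ) : PrimesHaveLevelFixedResidue h θ := by
  intro A hA ε hε
  refine IsBigO.trans (IsBigO.of_bound 1 ?_) (hθ A hA ε hε)
  filter_upwards [eventually_ge_atTop (1 : ℝ)] with x hx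
  rw [one_mul, Real.norm_eq_abs, Real.norm_eq_abs, abs_of_nonneg (fixedResidueSum_nonneg h x _),
    abs_of_nonneg (Finset.sum_nonneg fun q _ => primeAPError_nonneg x q)]
  exact fixedResidueSum_le_sum_primeAPError h hx _

/-- Sharp fixed-residue level `x^{θ'}` for every `θ' < θ` from `PrimesHaveLevel θ`. [folklore] -/
theorem _root_.Literature.NumberTheory.Sieve.PrimesHaveLevel.sharpFixedResidue {θ θ' : ℝ}
    (hθ : PrimesHaveLevel θ) (hlt : θ' < θ) (h : ℕ) : PrimesHaveSharpLevelFixedResidue h θ' := by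
  intro A hA
  have := hθ.fixedResidue h A hA (θ - θ') (by linarith)
  have e : θ - (θ - θ') = θ' := by ring
  rwa [e] at this

/-- **The crux implies the fixed-residue form** (every `h`): re-bridging a conditional route on
`ElliottHalberstamFixedResidue h` only weakens its premise. [folklore] -/
theorem elliottHalberstamFixedResidue_of_elliottHalberstam
    (hE : Literature.NumberTheory.Sieve.LevelOfDistribution.ElliottHalberstam) (h : ℕ) :
    ElliottHalberstamFixedResidue h := fun θ hθ => (hE θ hθ).fixedResidue h


/-! ### §2 The fixed-residue floor -/

/-- An integer with two distinct prime divisors is not a prime power. [folklore] -/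
theorem not_isPrimePow_of_two_primes {n p₁ p₂ : ℕ} (hp₁ : p₁.Prime) (hp₂ : p₂.Prime)
    (hne : p₁ ≠ p₂) (h₁ : p₁ ∣ n) (h₂ : p₂ ∣ n) : ¬ IsPrimePow n := by
  intro hn
  rw [isPrimePow_iff_unique_prime_dvd] at hn
  obtain ⟨r, -, hr⟩ := hn
  exact hne ((hr p₁ ⟨hp₁, h₁⟩).trans (hr p₂ ⟨hp₂, h₂⟩).symm)

/-- **Vanishing of `ψ(x; q, −h)` for a large modulus.** If `h < q`, `x + h < 2q` and `q − h` is not a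
prime power, then `ψ(x; q, −h) = 0`: the only `n ≤ x` with `q ∣ n + h` are `n + h ∈ {0, q}`.
[folklore] -/
theorem chebyshevPsiMod_neg_eq_zero {h q : ℕ} {x : ℝ} (hx : 0 ≤ x) (hqx : x + h < 2 * (q : ℝ))
    (hqh : h < q) (hnp : ¬ IsPrimePow (q - h)) :
    chebyshevPsiMod q (-((h : ℕ) : ZMod q)) x = 0 := by
  unfold chebyshevPsiMod
  refine Finset.sum_eq_zero fun n hn => ?_
  rw [Finset.mem_range] at hn
  simp only [ArithmeticFunction.vonMangoldt.residueClass, Set.indicator_apply, Set.mem_setOf_eq]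
  split_ifs with hmod
  · have hdvd : q ∣ n + h := by
      refine (ZMod.natCast_eq_zero_iff (n + h) q).mp ?_
      push_cast
      rw [hmod]
      ring
    obtain ⟨c, hc⟩ := hdvd
    have hnx : (n : ℝ) ≤ x := (Nat.le_floor_iff hx).mp (by omega)
    have hlt : n + h < 2 * q := by
      have : ((n + h : ℕ) : ℝ) < 2 * q := by push_cast; linarith
      exact_mod_cast this
    have hc2 : c < 2 := by
      by_contra hc2
      have hc2 : 2 ≤ c := Nat.le_of_not_lt hc2
      have : 2 * q ≤ q * c := by
        calc 2 * q = q * 2 := by ring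
          _ ≤ q * c := Nat.mul_le_mul_left q hc2
      omega
    interval_cases c
    · have hn0 : n = 0 := by omega
      subst hn0
      simp
    · have hn' : n = q - h := by omega
      rw [hn']
      exact ArithmeticFunction.vonMangoldt_eq_zero_iff.mpr hnp
  · rfl

/-- **The fixed-residue floor.** For every `h ≥ 1` there is `c = c(h) > 0` such that for all large
`x`, `∑_{q ≤ x, (q,h)=1} |ψ(x; q, −h) − x/φ(q)| ≥ c·x`.  Witness moduli: `q = h + p₁p₂(1 + hk)` in
`((x+h)/2, x]`, where `h < p₁ < p₂` are primes; then `(q, h) = 1`, the class `−h (mod q)` meets `[0, x]`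
only in `n = q − h = p₁p₂(1 + hk)` (two distinct prime factors, so `Λ(n) = 0`), whence
`ψ(x; q, −h) = 0` against the main term `x/φ(q) ≥ x/q ≥ 1`; there are `≥ x/(8 p₁p₂h)` such `q`.
[folklore] -/
theorem fixedResidueSum_floor {h : ℕ} (hh : 1 ≤ h) :
    ∃ c : ℝ, 0 < c ∧ ∀ᶠ x : ℝ in atTop, c * x ≤ fixedResidueSum h x ⌊x⌋₊ := by
  -- two distinct primes above `h`
  obtain ⟨p₁, hp₁h, hp₁⟩ := Nat.exists_infinite_primes (h + 1)
  obtain ⟨p₂, hp₂h, hp₂⟩ := Nat.exists_infinite_primes (p₁ + 1)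
  have hne : p₁ ≠ p₂ := by omega
  have hcop₁ : Nat.Coprime p₁ h :=
    (Nat.Prime.coprime_iff_not_dvd hp₁).mpr (Nat.not_dvd_of_pos_of_lt (by omega) (by omega))
  have hcop₂ : Nat.Coprime p₂ h :=
    (Nat.Prime.coprime_iff_not_dvd hp₂).mpr (Nat.not_dvd_of_pos_of_lt (by omega) (by omega))
  have hp₁2 : 2 ≤ p₁ := hp₁.two_le
  have hp₂2 : 2 ≤ p₂ := hp₂.two_le
  set P : ℕ := p₁ * p₂ with hP
  have hPcop : Nat.Coprime P h := Nat.Coprime.mul_left hcop₁ hcop₂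
  have hP4 : 4 ≤ P := by rw [hP]; nlinarith
  set m : ℕ := P * h with hm
  set r : ℕ := h + P with hr
  have hm1 : 1 ≤ m := by rw [hm]; nlinarith
  have hmpos : (0 : ℝ) < m := by exact_mod_cast hm1
  have hm0 : (m : ℝ) ≠ 0 := hmpos.ne'
  have hrh : (h : ℝ) ≤ r := by rw [hr]; push_cast; linarith [(Nat.cast_nonneg P : (0 : ℝ) ≤ P)]
  refine ⟨1 / (8 * m), by positivity, ?_⟩
  filter_upwards [eventually_ge_atTop (16 * ((r : ℝ) + m))] with x hx
  have hr0 : (0 : ℝ) ≤ r := Nat.cast_nonneg r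
  have hx0 : 0 ≤ x := by nlinarith
  -- the block of indices
  set k₀ : ℕ := ⌊x / (2 * m)⌋₊ + 1 with hk₀
  set K : ℕ := ⌊x / (4 * m)⌋₊ with hK
  have hk₀lo : x / (2 * m) < k₀ := by rw [hk₀]; push_cast; exact Nat.lt_floor_add_one _
  have hk₀hi : (k₀ : ℝ) ≤ x / (2 * m) + 1 := by
    rw [hk₀]; push_cast; linarith [Nat.floor_le (show 0 ≤ x / (2 * m) by positivity)]
  have hKhi : (K : ℝ) ≤ x / (4 * m) := Nat.floor_le (by positivity)
  have hKlo : x / (4 * m) - 1 < K := by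
    have := Nat.lt_floor_add_one (x / (4 * m)); rw [hK]; linarith
  -- the witness moduli `q_j = r + m (k₀ + j)`, `j < K`
  set qf : ℕ → ℕ := fun j => r + m * (k₀ + j) with hqf
  have hqf_inj : Set.InjOn qf (range K : Set ℕ) := by
    intro a _ b _ hab
    simp only [hqf] at hab
    have := Nat.eq_of_mul_eq_mul_left (by omega : 0 < m) (show m * (k₀ + a) = m * (k₀ + b) by omega)
    omega
  have hprop : ∀ j ∈ range K, (1 ≤ qf j ∧ qf j ≤ ⌊x⌋₊ ∧ (qf j).Coprime h) ∧
      (1 : ℝ) ≤ |chebyshevPsiMod (qf j) (-((h : ℕ) : ZMod (qf j))) x - x / Nat.totient (qf j)| := by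
    intro j hj
    rw [Finset.mem_range] at hj
    have hj1 : (j : ℝ) + 1 ≤ K := by exact_mod_cast hj
    have e : qf j = h + P * (1 + h * (k₀ + j)) := by
      show r + m * (k₀ + j) = h + P * (1 + h * (k₀ + j))
      rw [hr, hm]; ring
    have hqR : ((qf j : ℕ) : ℝ) = r + m * (k₀ + j) := by
      show ((r + m * (k₀ + j) : ℕ) : ℝ) = r + m * (k₀ + j)
      push_cast; ring
    -- size of q_j
    have hlow : x + h < 2 * ((qf j : ℕ) : ℝ) := by
      rw [hqR]
      have h1 : x < 2 * ((m : ℝ) * k₀) := by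
        have := (div_lt_iff₀ (by positivity : (0 : ℝ) < 2 * m)).mp hk₀lo
        linarith
      have hj0 : (0 : ℝ) ≤ (m : ℝ) * j := by positivity
      linarith
    have hupp : ((qf j : ℕ) : ℝ) ≤ x := by
      rw [hqR]
      have h1 : (k₀ : ℝ) + j ≤ x / (2 * m) + x / (4 * m) := by linarith
      have e1 : (m : ℝ) * (x / (2 * m)) = x / 2 := by field_simp
      have e2 : (m : ℝ) * (x / (4 * m)) = x / 4 := by field_simp
      have h2 : (m : ℝ) * (k₀ + j) ≤ 3 * x / 4 := by
        calc (m : ℝ) * (k₀ + j) ≤ m * (x / (2 * m) + x / (4 * m)) :=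
              mul_le_mul_of_nonneg_left h1 hmpos.le
          _ = 3 * x / 4 := by rw [mul_add, e1, e2]; ring
      have h3 : (r : ℝ) ≤ x / 4 := by linarith
      linarith
    have hqh : h < qf j := by
      have : P ≤ P * (1 + h * (k₀ + j)) := Nat.le_mul_of_pos_right _ (by omega)
      omega
    have hq1 : 1 ≤ qf j := by omega
    -- coprimality with `h`
    have hcopq : (qf j).Coprime h := by
      rw [e, Nat.coprime_self_add_left]
      exact Nat.Coprime.mul_left hPcop
        ((Nat.coprime_add_mul_left_left 1 h (k₀ + j)).mpr (Nat.coprime_one_left h))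
    -- `q_j - h` is not a prime power
    have hnp : ¬ IsPrimePow (qf j - h) := by
      rw [e, Nat.add_sub_cancel_left]
      exact not_isPrimePow_of_two_primes hp₁ hp₂ hne
        (dvd_mul_of_dvd_left (dvd_mul_right p₁ p₂) _) (dvd_mul_of_dvd_left (dvd_mul_left p₂ p₁) _)
    have hvan := chebyshevPsiMod_neg_eq_zero hx0 hlow hqh hnp
    refine ⟨⟨hq1, Nat.le_floor hupp, hcopq⟩, ?_⟩
    rw [hvan, zero_sub, abs_neg]
    have hφpos : (0 : ℝ) < Nat.totient (qf j) := by exact_mod_cast Nat.totient_pos.mpr (by omega)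
    have hφle : (Nat.totient (qf j) : ℝ) ≤ qf j := by exact_mod_cast Nat.totient_le _
    rw [abs_of_nonneg (div_nonneg hx0 hφpos.le), le_div_iff₀ hφpos, one_mul]
    linarith
  -- assemble
  have hsubset : (range K).image qf ⊆ (Icc 1 ⌊x⌋₊).filter (fun q => q.Coprime h) := by
    intro q hq
    rw [Finset.mem_image] at hq
    obtain ⟨j, hj, rfl⟩ := hq
    rw [Finset.mem_filter, Finset.mem_Icc]
    exact ⟨⟨(hprop j hj).1.1, (hprop j hj).1.2.1⟩, (hprop j hj).1.2.2⟩
  have hT : ∀ q ∈ (range K).image qf,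
      (1 : ℝ) ≤ |chebyshevPsiMod q (-((h : ℕ) : ZMod q)) x - x / Nat.totient q| := by
    intro q hq
    rw [Finset.mem_image] at hq
    obtain ⟨j, hj, rfl⟩ := hq
    exact (hprop j hj).2
  have hcard : ((range K).image qf).card = K := by
    rw [Finset.card_image_of_injOn hqf_inj, Finset.card_range]
  have h8 : x / (8 * m) ≤ K := by
    have hA : x / (8 * m) ≤ x / (4 * m) - 1 := by
      rw [div_le_iff₀ (by positivity : (0 : ℝ) < 8 * m)]
      have e3 : (x / (4 * m) - 1) * (8 * m) = 2 * x - 8 * m := by field_simp; ring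
      rw [e3]
      nlinarith
    linarith
  unfold fixedResidueSum
  calc 1 / (8 * m) * x = x / (8 * m) := by ring
    _ ≤ K := h8
    _ = ∑ q ∈ (range K).image qf, (1 : ℝ) := by
        rw [Finset.sum_const, hcard, nsmul_eq_mul, mul_one]
    _ ≤ ∑ q ∈ (range K).image qf, |chebyshevPsiMod q (-((h : ℕ) : ZMod q)) x - x / Nat.totient q| :=
        Finset.sum_le_sum hT
    _ ≤ ∑ q ∈ (Icc 1 ⌊x⌋₊).filter (fun q => q.Coprime h),
          |chebyshevPsiMod q (-((h : ℕ) : ZMod q)) x - x / Nat.totient q| :=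
        Finset.sum_le_sum_of_subset_of_nonneg hsubset fun _ _ _ => abs_nonneg _

/-! ### §3 Consequences: the endpoint is false in the fixed-residue form too -/

/-- **Even for one fixed class and the single height `y = x`, level `x` exactly is false**: for every
`h ≥ 1`, `∑_{q ≤ x, (q,h)=1} |ψ(x; q, −h) − x/φ(q)|` is not `O(x/(log x)^A)` for any `A > 0`.  So the
endpoint failure of the crux (`not_primesHaveSharpLevel_one`, `EHFloor.not_isBigO_levelSum_of_one_le`)
is not an artefact of the suprema over heights and classes. [folklore] -/
theorem not_primesHaveSharpLevelFixedResidue_one {h : ℕ} (hh : 1 ≤ h) :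
    ¬ PrimesHaveSharpLevelFixedResidue h 1 := by
  intro hS
  obtain ⟨c, hc, hev⟩ := fixedResidueSum_floor hh
  refine Summit.Parity.GeneralizedHardyLittlewood.Theorems.EH.Negative.not_isBigO_div_log_rpow
    hc one_pos ?_ (hS 1 one_pos)
  filter_upwards [hev] with x hx
  rwa [Real.rpow_one]

/-- **`θ > 1` fails in the fixed-residue form** (level `x^{θ−ε}` with `ε = (θ−1)/2` contains all
`q ≤ x`). [folklore] -/
theorem not_primesHaveLevelFixedResidue_of_one_lt {h : ℕ} (hh : 1 ≤ h) {θ : ℝ} (hθ : 1 < θ) :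
    ¬ PrimesHaveLevelFixedResidue h θ := by
  intro hL
  obtain ⟨c, hc, hev⟩ := fixedResidueSum_floor hh
  refine Summit.Parity.GeneralizedHardyLittlewood.Theorems.EH.Negative.not_isBigO_div_log_rpow
    hc one_pos ?_ (hL 1 one_pos ((θ - 1) / 2) (by linarith))
  filter_upwards [hev, eventually_ge_atTop (1 : ℝ)] with x hx hx1
  refine hx.trans (fixedResidueSum_mono h x (Nat.floor_le_floor ?_))
  calc x = x ^ (1 : ℝ) := (Real.rpow_one x).symm
    _ ≤ x ^ (θ - (θ - 1) / 2) := Real.rpow_le_rpow_of_exponent_le hx1 (by linarith)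

/-- The fixed-residue Elliott–Halberstam statement with `θ < 1` DROPPED is false (every `h ≥ 1`): the
open quantifier `θ < 1` is load-bearing in the fixed-residue form exactly as in the crux. [folklore] -/
theorem elliottHalberstamFixedResidue_false_without_ltOne {h : ℕ} (hh : 1 ≤ h) :
    ¬ ∀ θ : ℝ, PrimesHaveLevelFixedResidue h θ := fun hall =>
  not_primesHaveLevelFixedResidue_of_one_lt hh one_lt_two (hall 2)

/-- Sharp fixed-residue level `x^θ` for every `θ < 1` DOES follow from the crux, while `θ = 1` is false
(`not_primesHaveSharpLevelFixedResidue_one`): in the fixed-residue form, as in the crux itself, the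
statement is exactly everything short of the trivially false endpoint. [folklore] -/
theorem sharpFixedResidue_of_elliottHalberstam
    (hE : Literature.NumberTheory.Sieve.LevelOfDistribution.ElliottHalberstam) (h : ℕ) {θ : ℝ} (hθ : θ < 1) :
    PrimesHaveSharpLevelFixedResidue h θ :=
  (hE ((θ + 1) / 2) (by linarith)).sharpFixedResidue (by linarith) h

end Summit.Parity.GeneralizedHardyLittlewood.Theorems.ElliottHalberstam.Negative
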